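import Literature.Computability.Cryptography.PeriodFindingEmbed
import HarnessLib

/-!
# Period finding by eigenvalue estimation of shifts — the block reading the INPUT register

Topic `Computability/Cryptography`; a variant of the classical block of the shift experiment
(`PeriodFindingBlock.lean`, `PeriodFindingEmbed.lean`; Aaronson–Chen 2017 Lemma 7.5 / Boneh–Lipton /
Kitaev) for applications whose oracle tables depend on the INPUT and not only on its length —
Hallgren's algorithm (`HallgrenPell.lean`: the table of the walk of the real quadratic order of
discriminant read off the input) and, generally, period finding of an input-dependent
polynomial-time table presented through an oracle language in `P` (the oracle gates are removed
at the end by `ShorAssembly.isQSolvable_of_mem_BQP_oracle`). The original block queries the oracle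
on `cpre j ++ bits(X_u)` with CONSTANT prefixes `cpre j`; here every query is PREFIXED BY THE INPUT
WIRES: `x ++ cpre j ++ bits(X_u)`. Nothing of the block is copied: the new wire type is
`Fin nIn ⊕ BW S`, the compute/uncompute parts are the old ones transported along `Sum.inr`
(`OSim.ocEval_map_comp`), only the query list is new. Theorem-and-definition file, no named facts.

* `BWI`, `w₀I`, `inWires`, `qWiresI`, `qOpsI`, **`blockOpsI`**, `ansI`, `wFinI`, and the semantics
  **`ocEval_blockOpsI`**: controls, offsets and inputs unchanged, answer bit `(u, j)` equal to
  `[x ++ cpre j ++ bits(X_u) ∈ A]`, every other wire back to `0` (Nielsen–Chuang §3.2.5;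
  Bernstein–Vazirani 1997 §8.3);
* the placement in the sandwich register `x (y Z) ρ` (`finAddrI`: inputs on the input wires, the
  rest as in `PeriodFindingEmbed.finAddr`), `blockCircI`, **`blockCircI_mulVec_coinInput`**
  (`V |x (y Z) 0^m⟩ = |x (y Z) (R_x y Z)⟩`), the answer tables **`FuI A xs u v`**
  (`([xs ++ cpre j ++ bits_L(v) ∈ A])_{j<L}`) and `blockRI_eq_iff`.

## References

* E. Bernstein, U. Vazirani, SIAM J. Comput. 26 (1997), §8.3 (oracle gates on basis states)
  [BernsteinVazirani1997SICOMP].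
* M. A. Nielsen, I. L. Chuang, *Quantum Computation and Quantum Information*, CUP 2010, §3.2.5
  [NielsenChuang2010].
* A. Yu. Kitaev, arXiv:quant-ph/9511026 (1995), §3 Lemma 10 [Kitaev1995].
* S. Hallgren, J. ACM 54 (2007), Art. 4, §4 (the periodic function is evaluated on the input d)
  [Hallgren2007].
-/

noncomputable section

namespace Literature.Computability.Cryptography

namespace PeriodFinding

open QuantumComplexity QuantumComplexity.RazTalMachine QuantumComplexity.RevSim QuantumComplexity.OSim
  Finset Function Matrix Kitaev1995

variable (S : BSpec) (nIn : ℕ)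

/-! ### The block over `Fin nIn ⊕ BW S` -/

/-- **The wires**: the input wires, then the structured wires of the block. [folklore] -/
abbrev BWI : Type := Fin nIn ⊕ BW S

variable {nIn}

/-- The initial assignment: input `x`, controls `y`, offsets `Z`, all else `0`. [folklore] -/
def w₀I (x : Fin nIn → Bool) (y : Fin S.nU → Fin S.K → Bool) (Z : Fin S.nU → Fin S.Ltop → Bool) :
    BWI S nIn → Bool :=
  Sum.elim x (w₀ S y Z)

variable (nIn)

/-- The input wires, in order. [folklore] -/
def inWires : List (BWI S nIn) := (List.finRange nIn).map Sum.inl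

/-- The query wires of query `(u, j)`: the input, then prefix `j`, then `X_u`. [cite: Hallgren2007, §4] -/
def qWiresI (a : Σ u : Fin S.nU, Fin (S.L u)) : List (BWI S nIn) := inWires S nIn ++ (qWires S a).map Sum.inr

/-- The answer wire of query `(u, j)`. [folklore] -/
def qTgtI (a : Σ u : Fin S.nU, Fin (S.L u)) : BWI S nIn := Sum.inr (qTgt S a)

/-- **The queries.** [cite: BernsteinVazirani1997SICOMP, §8.3] -/
def qOpsI : List (RtOp (BWI S nIn)) := (qIdx S).map fun a => RtOp.oracle (qWiresI S nIn a) (qTgtI S nIn a)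

/-- The compute part, transported. [folklore] -/
def wOpsI : List (RtOp (BWI S nIn)) := ((wOps S).map RtOp.cl).map (RtOp.map Sum.inr)

/-- The uncompute part, transported. [folklore] -/
def wOpsRevI : List (RtOp (BWI S nIn)) := ((wOps S).reverse.map RtOp.cl).map (RtOp.map Sum.inr)

/-- **The block**: compute, query (input-prefixed), uncompute. [cite: NielsenChuang2010, §3.2.5] -/
def blockOpsI : List (RtOp (BWI S nIn)) := wOpsI S nIn ++ qOpsI S nIn ++ wOpsRevI S nIn

variable {nIn} (x : Fin nIn → Bool) (y : Fin S.nU → Fin S.K → Bool) (Z : Fin S.nU → Fin S.Ltop → Bool)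

/-- The answer to query `(u, j)`: `[x ++ cpre j ++ bits(X_u) ∈ A]`. [cite: Hallgren2007, §4] -/
def ansI (A : Language Bool) (u : Fin S.nU) (j : Fin (S.L u)) : Bool :=
  A.boolIndicator (List.ofFn x ++ (S.cpre j ++ xbits S y Z u))

/-- **The final assignment**: inputs, controls and offsets unchanged, the answers on the answer
wires, everything else `0`. [cite: NielsenChuang2010, §3.2.5] -/
def wFinI (A : Language Bool) : BWI S nIn → Bool :=
  Sum.elim x fun a => match a with
    | .yreg u i => if h : (i : ℕ) < S.L u then ansI S x y Z A u ⟨i, h⟩ else false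
    | a => w₀ S y Z a

variable {S x y Z}

/-- The transported compute part acts as the compute part on the block wires and fixes the input.
[folklore] -/
theorem ocEval_wOpsI (A : Language Bool) (w : BWI S nIn → Bool) :
    ocEval A (wOpsI S nIn) w = Sum.elim (w ∘ Sum.inl) (clEval (wOps S) (w ∘ Sum.inr)) := by
  funext a
  rcases a with i | a
  · exact ocEval_map_apply_of_not_mem_range A _ _ _ (by rintro ⟨b, hb⟩; cases hb)
  · have := congrFun (ocEval_map_comp A Sum.inr_injective ((wOps S).map RtOp.cl) w) a
    simp only [Function.comp_apply] at this
    rw [wOpsI, this, ocEval_map_cl]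
    rfl

/-- The transported uncompute part, likewise. [folklore] -/
theorem ocEval_wOpsRevI (A : Language Bool) (w : BWI S nIn → Bool) :
    ocEval A (wOpsRevI S nIn) w = Sum.elim (w ∘ Sum.inl) (clEval (wOps S).reverse (w ∘ Sum.inr)) := by
  funext a
  rcases a with i | a
  · exact ocEval_map_apply_of_not_mem_range A _ _ _ (by rintro ⟨b, hb⟩; cases hb)
  · have := congrFun (ocEval_map_comp A Sum.inr_injective ((wOps S).reverse.map RtOp.cl) w) a
    simp only [Function.comp_apply] at this
    rw [wOpsRevI, this, ocEval_map_cl]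
    rfl

/-- The answer wires of the queries are pairwise distinct. [folklore] -/
theorem map_qTgtI_nodup : ((qIdx S).map (qTgtI S nIn)).Nodup := by
  refine (List.Nodup.map (fun a b h => qTgt_injective (Sum.inr_injective h))) ?_
  unfold qIdx
  rw [List.nodup_flatMap]
  exact ⟨fun u _ => (List.nodup_finRange _).map (fun j j' h => by simpa using h),
    (List.nodup_finRange _).pairwise_of_forall_ne fun u _ u' _ huu => by
      simp only [Function.onFun, List.disjoint_left, List.mem_map]
      rintro _ ⟨j, -, rfl⟩ ⟨j', -, h⟩
      exact huu (congrArg Sigma.fst h).symm⟩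

/-- No answer wire is a query wire. [folklore] -/
theorem qTgtI_not_mem_qWiresI (a b : Σ u : Fin S.nU, Fin (S.L u)) : qTgtI S nIn a ∉ qWiresI S nIn b := by
  intro h
  rw [qWiresI, List.mem_append] at h
  rcases h with h | h
  · rw [inWires, List.mem_map] at h
    obtain ⟨i, -, e⟩ := h
    simp [qTgtI] at e
  · rw [List.mem_map] at h
    obtain ⟨c, hc, e⟩ := h
    simp only [qTgtI, Sum.inr.injEq] at e
    subst e
    exact qTgt_not_mem_qWires a b hc

/-- Membership of a query index. [folklore] -/
theorem mem_qIdx (u : Fin S.nU) (j : Fin (S.L u)) : (⟨u, j⟩ : Σ u : Fin S.nU, Fin (S.L u)) ∈ qIdx S := by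
  unfold qIdx
  exact List.mem_flatMap.2 ⟨u, List.mem_finRange u, List.mem_map.2 ⟨j, List.mem_finRange _, rfl⟩⟩

/-- **The queries**: answer wire `(u, i)`, `i < L u`, receives `[qWiresI (u, i) read in w ∈ A]`;
nothing else changes (answer wires initially clear). [cite: BernsteinVazirani1997SICOMP, §8.3] -/
theorem ocEval_qOpsI (A : Language Bool) (w : BWI S nIn → Bool) (hy : ∀ u i, w (Sum.inr (BW.yreg u i)) = false) :
    ocEval A (qOpsI S nIn) w = fun a => match a with
      | Sum.inr (.yreg u i) =>
          if h : (i : ℕ) < S.L u then A.boolIndicator ((qWiresI S nIn ⟨u, ⟨i, h⟩⟩).map w) else false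
      | a => w a := by
  obtain ⟨h1, h2⟩ := ocEval_oracles A (qWiresI S nIn) (qTgtI S nIn) (qIdx S) map_qTgtI_nodup
    (fun a _ b _ => qTgtI_not_mem_qWiresI a b) w
  funext a
  rcases a with k | a
  · exact h2 _ fun b _ e => by simp [qTgtI] at e
  cases a with
  | yreg u i =>
    show ocEval A (qOpsI S nIn) w (Sum.inr (BW.yreg u i)) =
      if h : (i : ℕ) < S.L u then A.boolIndicator ((qWiresI S nIn ⟨u, ⟨i, h⟩⟩).map w) else false
    by_cases hi : (i : ℕ) < S.L u
    · have := h1 _ (mem_qIdx u ⟨i, hi⟩)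
      have hq : qTgtI S nIn ⟨u, ⟨i, hi⟩⟩ = Sum.inr (BW.yreg u i) := by simp [qTgtI, qTgt]
      rw [hq] at this
      rw [qOpsI, this, hy, dif_pos hi, Bool.false_xor]
    · rw [qOpsI, h2 _ fun b _ e => hi ?_, hy, dif_neg hi]
      simp only [qTgtI, qTgt, Sum.inr.injEq, BW.yreg.injEq] at e
      obtain ⟨rfl, rfl⟩ := e
      exact b.2.isLt
  | ctrl u s => exact h2 _ fun b _ e => by simp [qTgtI, qTgt] at e
  | zbit u i => exact h2 _ fun b _ e => by simp [qTgtI, qTgt] at e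
  | pre j p => exact h2 _ fun b _ e => by simp [qTgtI, qTgt] at e
  | dreg u s i => exact h2 _ fun b _ e => by simp [qTgtI, qTgt] at e
  | sreg u s i => exact h2 _ fun b _ e => by simp [qTgtI, qTgt] at e
  | creg u s i => exact h2 _ fun b _ e => by simp [qTgtI, qTgt] at e

/-- **The queries read the input, the prefixes and `X_u`.** [cite: Hallgren2007, §4] -/
theorem map_qWiresI (u : Fin S.nU) (j : Fin (S.L u)) :
    (qWiresI S nIn ⟨u, j⟩).map (Sum.elim x (clEval (wOps S) (w₀ S y Z))) =
      List.ofFn x ++ (S.cpre j ++ xbits S y Z u) := by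
  rw [qWiresI, List.map_append, List.map_map, ← map_qWires (y := y) (Z := Z) u j, inWires, List.map_map,
    List.ofFn_eq_map]
  rfl

/-- **Semantics of the block** (compute–query–uncompute): inputs, controls and offsets unchanged,
the answer bit `(u, j)` equal to `[x ++ cpre j ++ bits(X_u) ∈ A]`, every other wire back to `0`.
[cite: NielsenChuang2010, §3.2.5] -/
theorem ocEval_blockOpsI (A : Language Bool) : ocEval A (blockOpsI S nIn) (w₀I S x y Z) = wFinI S x y Z A := by
  rw [blockOpsI, ocEval_append, ocEval_append, ocEval_wOpsI]
  have hinl : (w₀I S x y Z) ∘ Sum.inl = x := rfl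
  have hinr : (w₀I S x y Z) ∘ Sum.inr = w₀ S y Z := rfl
  rw [hinl, hinr]
  obtain ⟨hW1, -⟩ := clEval_wOps (y := y) (Z := Z) (S := S)
  have hy : ∀ u i, (Sum.elim x (clEval (wOps S) (w₀ S y Z)) : BWI S nIn → Bool) (Sum.inr (BW.yreg u i)) = false :=
    fun u i => by
      show clEval (wOps S) (w₀ S y Z) (BW.yreg u i) = false
      rw [hW1 _ fun q => id, w₁_apply]; rfl
  rw [ocEval_qOpsI A _ hy, ocEval_wOpsRevI]
  -- the queried state restricted to the block wires, as a modification on the answer wires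
  set g : BW S → Bool := fun a => match a with
    | .yreg u i => if h : (i : ℕ) < S.L u then ansI S x y Z A u ⟨i, h⟩ else false
    | _ => false with hg
  have hres : ((fun a : BWI S nIn => match a with
      | Sum.inr (.yreg u i) =>
          if h : (i : ℕ) < S.L u then
            A.boolIndicator ((qWiresI S nIn ⟨u, ⟨i, h⟩⟩).map (Sum.elim x (clEval (wOps S) (w₀ S y Z)))) else false
      | a => Sum.elim x (clEval (wOps S) (w₀ S y Z)) a) ∘ Sum.inr) =
      fun a => if IsY a then g a else clEval (wOps S) (w₀ S y Z) a := by
    funext a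
    cases a with
    | yreg u i =>
      simp only [Function.comp_apply, IsY, if_true, hg]
      split_ifs with h
      · rw [map_qWiresI]; rfl
      · rfl
    | _ => rfl
  have hinl' : ((fun a : BWI S nIn => match a with
      | Sum.inr (.yreg u i) =>
          if h : (i : ℕ) < S.L u then
            A.boolIndicator ((qWiresI S nIn ⟨u, ⟨i, h⟩⟩).map (Sum.elim x (clEval (wOps S) (w₀ S y Z)))) else false
      | a => Sum.elim x (clEval (wOps S) (w₀ S y Z)) a) ∘ Sum.inl) = x := by
    funext i; rfl
  rw [hres, hinl', clEval_ite (IsY (S := S)) _ (fun op hop => wOps_avoid_Y op (List.mem_reverse.1 hop)),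
    clEval_reverse_clEval _ wOps_wf]
  funext a
  rcases a with i | a
  · rfl
  · cases a <;> simp [IsY, hg, wFinI, w₀]

/-! ### Placing the block in the sandwich register -/

variable (S) (n : ℕ)

/-- **The placement**: input wire `i` on input wire `i`, the block wires as in `finAddr`. [folklore] -/
def finAddrI : BWI S n → Fin (NN S n) := Sum.elim (Fin.castAdd _) (finAddr S n)

variable {S n}

/-- Block wires are placed beyond the input. [folklore] -/
theorem le_finAddr (a : BW S) : n ≤ (finAddr S n a : ℕ) := by
  unfold finAddr place
  rcases code S a with j | j | q
  · simp [yWire, coinWire]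
  · simp [zWire, coinWire]
  · simp [workWire]

/-- The placement is injective. [folklore] -/
theorem finAddrI_injective : Injective (finAddrI S n) := by
  rintro (i | a) (i' | a') h
  · simp only [finAddrI, Sum.elim_inl] at h
    exact congrArg Sum.inl (Fin.castAdd_injective _ _ h)
  · exfalso
    have h1 := le_finAddr (n := n) a'
    have h2 : ((finAddrI S n (Sum.inl i) : Fin _) : ℕ) = i := by simp [finAddrI]
    have := congrArg Fin.val h
    rw [h2] at this
    simp only [finAddrI, Sum.elim_inr] at this
    omega
  · exfalso
    have h1 := le_finAddr (n := n) a
    have h2 : ((finAddrI S n (Sum.inl i') : Fin _) : ℕ) = i' := by simp [finAddrI]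
    have := congrArg Fin.val h
    rw [h2] at this
    simp only [finAddrI, Sum.elim_inr] at this
    omega
  · simp only [finAddrI, Sum.elim_inr] at h
    exact congrArg Sum.inr (finAddr_injective h)

variable (S n)

/-- Every operation of the block is classical or a query. [folklore] -/
theorem blockOpsI_isCl : ∀ op ∈ blockOpsI S n, IsCl op := by
  intro op hop
  simp only [blockOpsI, wOpsI, wOpsRevI, qOpsI, List.mem_append, List.mem_map] at hop
  rcases hop with (⟨_, ⟨a, -, rfl⟩, rfl⟩ | ⟨a, -, rfl⟩) | ⟨_, ⟨a, -, rfl⟩, rfl⟩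
  · trivial
  · trivial
  · trivial

/-- The query wires and the answer wire of a query are pairwise distinct. [folklore] -/
theorem qWiresI_qTgtI_nodup (a : Σ u : Fin S.nU, Fin (S.L u)) : (qWiresI S n a ++ [qTgtI S n a]).Nodup := by
  have hold := qWires_qTgt_nodup S a
  rw [List.nodup_append] at hold ⊢
  obtain ⟨h1, -, h3⟩ := hold
  refine ⟨?_, List.nodup_singleton _, fun b hb c hc e => ?_⟩
  · rw [qWiresI, List.nodup_append]
    refine ⟨(List.nodup_finRange _).map (fun i i' h => by simpa using h), h1.map Sum.inr_injective,
      fun b hb c hc e => ?_⟩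
    subst e
    simp only [inWires, List.mem_map] at hb
    obtain ⟨i, -, rfl⟩ := hb
    simp at hc
  · rw [List.mem_singleton] at hc
    subst hc; subst e
    exact qTgtI_not_mem_qWiresI a a hb

/-- Every operation of the block is well formed. [folklore] -/
theorem blockOpsI_rwf : ∀ op ∈ blockOpsI S n, op.WF := by
  intro op hop
  simp only [blockOpsI, wOpsI, wOpsRevI, qOpsI, List.mem_append, List.mem_map] at hop
  rcases hop with (⟨_, ⟨a, ha, rfl⟩, rfl⟩ | ⟨a, -, rfl⟩) | ⟨_, ⟨a, ha, rfl⟩, rfl⟩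
  · exact (show RtOp.WF (RtOp.cl a) from wOps_wf a ha).map_of_injOn fun b _ b' _ h => Sum.inr_injective h
  · exact qWiresI_qTgtI_nodup S n a
  · exact (show RtOp.WF (RtOp.cl a) from wf_reverse wOps_wf a ha).map_of_injOn
      fun b _ b' _ h => Sum.inr_injective h

/-- **The block placed in the register.** [folklore] -/
def blockOpsNI : List (RtOp (Fin (NN S n))) := (blockOpsI S n).map (RtOp.map (finAddrI S n))

/-- Placed operations are classical or queries. [folklore] -/
theorem blockOpsNI_isCl : ∀ op ∈ blockOpsNI S n, IsCl op := by
  intro op hop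
  obtain ⟨op', hop', rfl⟩ := List.mem_map.1 hop
  exact (blockOpsI_isCl S n op' hop').map _

/-- Placed operations are well formed. [folklore] -/
theorem blockOpsNI_wf : ∀ op ∈ blockOpsNI S n, op.WF := by
  intro op hop
  obtain ⟨op', hop', rfl⟩ := List.mem_map.1 hop
  exact (blockOpsI_rwf S n op' hop').map_of_injOn fun a _ a' _ h => finAddrI_injective h

/-- **The input-reading block as a Clifford+T circuit with oracle gates.** [cite: BernsteinVazirani1997SICOMP, §8.3] -/
def blockCircI : QCircuit cliffordT (NN S n) := ⟨RtOp.compileList (blockOpsNI S n) (blockOpsNI_wf S n)⟩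

variable {S n}

/-- **The basis label `x (y Z) 0^m` pulled back to the wires is the initial assignment.** [folklore] -/
theorem coinInput_comp_finAddrI (x : QReg n) (yf : QReg (k₁ S)) (Z : QReg (k₂ S)) :
    (coinInput x (Fin.append yf Z) : QReg (NN S n)) ∘ finAddrI S n = w₀I S x (yOfFlat S yf) (zOfFlat S Z) := by
  funext a
  rcases a with i | a
  · show coinInput x (Fin.append yf Z) (Fin.castAdd _ i) = x i
    exact coinInput_castAdd x _ i
  · show ((coinInput x (Fin.append yf Z) : QReg (NN S n)) ∘ finAddr S n) a = w₀ S (yOfFlat S yf) (zOfFlat S Z) a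
    rw [coinInput_comp_finAddr]

variable (S n)

/-- **The work-register content written by the block** relative to `A` on `x (y Z) 0^m`. [folklore] -/
def blockRI (A : Language Bool) (x : QReg n) (yf : QReg (k₁ S)) (Z : QReg (k₂ S)) : QReg (mW S) := fun l =>
  wFinI S x (yOfFlat S yf) (zOfFlat S Z) A (Sum.inr (ofWIdx S ((workEquiv S).symm l)))

variable {S n}

/-- **The block acts on `x (y Z) 0^m` as `|x (y Z) 0^m⟩ ↦ |x (y Z) (R_x y Z)⟩`** (hypothesis `hV` of
the read-out law). [cite: BernsteinVazirani1997SICOMP, §8.3] -/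
theorem blockCircI_mulVec_coinInput (A : Language Bool) (x : QReg n) (yf : QReg (k₁ S)) (Z : QReg (k₂ S)) :
    (blockCircI S n).toMatrix A *ᵥ basisState (coinInput x (Fin.append yf Z)) =
      basisState (tri x (Fin.append yf Z) (blockRI S n A x yf Z)) := by
  rw [blockCircI, compileList_mulVec_basisState A _ (blockOpsNI_isCl S n) (blockOpsNI_wf S n)]
  congr 1
  funext q
  by_cases hq : q ∈ Set.range (finAddrI S n)
  · obtain ⟨a, rfl⟩ := hq
    rw [blockOpsNI, show ocEval A ((blockOpsI S n).map (RtOp.map (finAddrI S n)))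
        (coinInput x (Fin.append yf Z)) (finAddrI S n a) =
        ocEval A (blockOpsI S n) ((coinInput x (Fin.append yf Z) : QReg (NN S n)) ∘ finAddrI S n) a from
      congrFun (ocEval_map_comp A finAddrI_injective _ _) a, coinInput_comp_finAddrI, ocEval_blockOpsI]
    rcases a with i | a
    · show x i = tri x (Fin.append yf Z) _ (Fin.castAdd _ i)
      rw [tri_castAdd]
    cases a with
    | ctrl u s =>
      show yOfFlat S yf u s = tri x (Fin.append yf Z) _ (yWire n (k₁ S) (k₂ S) (mW S) _)
      rw [tri_yWire]
      rfl
    | zbit u i =>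
      show zOfFlat S Z u i = tri x (Fin.append yf Z) _ (zWire n (k₁ S) (k₂ S) (mW S) _)
      rw [tri_zWire]
      rfl
    | pre j p =>
      show _ = tri x _ (blockRI S n A x yf Z) (workWire S n _)
      rw [workWire, tri_work, blockRI, Equiv.symm_apply_apply, ofWIdx, Equiv.symm_apply_apply]
    | dreg u s i =>
      show _ = tri x _ (blockRI S n A x yf Z) (workWire S n _)
      rw [workWire, tri_work, blockRI, Equiv.symm_apply_apply]
      rfl
    | sreg u s i =>
      show _ = tri x _ (blockRI S n A x yf Z) (workWire S n _)
      rw [workWire, tri_work, blockRI, Equiv.symm_apply_apply]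
      rfl
    | creg u s i =>
      show _ = tri x _ (blockRI S n A x yf Z) (workWire S n _)
      rw [workWire, tri_work, blockRI, Equiv.symm_apply_apply]
      rfl
    | yreg u i =>
      show _ = tri x _ (blockRI S n A x yf Z) (workWire S n _)
      rw [workWire, tri_work, blockRI, Equiv.symm_apply_apply]
      rfl
  · rw [blockOpsNI, ocEval_map_apply_of_not_mem_range A _ _ _ hq]
    induction q using Fin.addCases with
    | left i => exact absurd ⟨Sum.inl i, rfl⟩ hq
    | right q =>
      exfalso
      induction q using Fin.addCases with
      | left c =>
        induction c using Fin.addCases with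
        | left j =>
          obtain ⟨a, ha⟩ := yWire_mem_range (S := S) (n := n) j
          exact hq ⟨Sum.inr a, ha⟩
        | right j =>
          obtain ⟨a, ha⟩ := zWire_mem_range (S := S) (n := n) j
          exact hq ⟨Sum.inr a, ha⟩
      | right l =>
        obtain ⟨a, ha⟩ := workWire_mem_range (S := S) (n := n) l
        exact hq ⟨Sum.inr a, ha⟩

/-! ### The fibres of `R` -/

variable (S)

/-- The tuple of answers of unit `u` as a function of the value of `X_u`, for input bits `xs`:
`([xs ++ cpre j ++ bits_L(v) ∈ A])_{j < L}`. [cite: Hallgren2007, §4] -/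
def FuI (A : Language Bool) (xs : List Bool) (u : Fin S.nU) (v : ℕ) : List Bool :=
  List.ofFn fun j : Fin (S.L u) => A.boolIndicator (xs ++ (S.cpre j ++ List.ofFn fun i : Fin (S.L u) => v.testBit i))

variable {S}

/-- The answers are the answer function at `X_u`. [folklore] -/
theorem ansI_eq_getElem_FuI (A : Language Bool) (x : Fin n → Bool) (y : Fin S.nU → Fin S.K → Bool)
    (Z : Fin S.nU → Fin S.Ltop → Bool) (u : Fin S.nU) (j : Fin (S.L u)) :
    ansI S x y Z A u j = (FuI S A (List.ofFn x) u (xval S y Z u)).getD j false := by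
  rw [FuI, List.getD_eq_getElem?_getD, List.getElem?_ofFn]
  simp [j.isLt, ansI, xbits]

/-- **The fibres of the work-register content**: `R_x y Z = R_x y' Z` iff every unit has the same
tuple of answers at `X_u`. [folklore] -/
theorem blockRI_eq_iff (A : Language Bool) (x : QReg n) (yf yf' : QReg (k₁ S)) (Z : QReg (k₂ S)) :
    blockRI S n A x yf Z = blockRI S n A x yf' Z ↔
      ∀ u, FuI S A (List.ofFn x) u (xval S (yOfFlat S yf) (zOfFlat S Z) u) =
        FuI S A (List.ofFn x) u (xval S (yOfFlat S yf') (zOfFlat S Z) u) := by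
  constructor
  · intro h u
    apply List.ext_getElem (by simp [FuI])
    intro j hj _
    have hj' : j < S.L u := by simpa [FuI] using hj
    have key := congrFun h (workEquiv S (Sum.inr (u, Sum.inr (up S ⟨j, hj'⟩))))
    simp only [blockRI, Equiv.symm_apply_apply, ofWIdx, wFinI, Sum.elim_inr, Fin.val_castLE, dif_pos hj'] at key
    rw [ansI_eq_getElem_FuI, ansI_eq_getElem_FuI, List.getD_eq_getElem?_getD, List.getD_eq_getElem?_getD,
      List.getElem?_eq_getElem hj, List.getElem?_eq_getElem (by simpa [FuI] using hj')] at key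
    simpa using key
  · intro h
    funext l
    simp only [blockRI]
    rcases (workEquiv S).symm l with q | ⟨u, ⟨s, i | i | i⟩ | i⟩
    · rfl
    · rfl
    · rfl
    · rfl
    · simp only [ofWIdx, wFinI, Sum.elim_inr]
      split_ifs with hi
      · rw [ansI_eq_getElem_FuI, ansI_eq_getElem_FuI, h u]
      · rfl

end PeriodFinding

end Literature.Computability.Cryptography

end
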